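import Literature.NumberTheory.GaloisRepresentations.LubinTateColemanInterpolationNorm
import HarnessLib

/-!
# The Coleman power series `g_β` of a norm-coherent sequence of units

De Shalit, *Iwasawa theory of elliptic curves with complex multiplication* (1987), Ch. I §2.2–2.3: "we
shall call `g_β(X)` Coleman's power series of `β`"; Corollary 2.3 (i) `g_{ββ'} = g_β · g_{β'}`,
(ii) `𝒩 g_β = g_β`. This file PACKAGES the interpolation theorem of `LubinTateColemanInterpolationNorm.lean`
(`exists_evalAt_cohPt_eq_of_towerNorm`, uniqueness `eq_of_forall_evalAt_cohPt_eq`) as a function on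
norm-coherent sequences, for `f = πX + X^q` over a non-archimedean local field `F` (everything **proved**):

* `NormCoherentUnits hπ` — sequences `β = (β_m)`, `β_m ∈ 𝒪_{K_π^{m+1}}` of norm `1`, with
  `N_{K_π^{m+1}/K_π^{n+1}}(β_m) = β_n` (`Algebra.norm` for the tower algebra); they form a commutative
  monoid under termwise multiplication (`mul`, `one`).
* `colemanSeries β = g_β` with ★ `evalAt_cohPt_colemanSeries` (**`g_β(ω_{m+1}) = β_m`**),
  ★ `colemanNorm_colemanSeries` (**`𝒩 g_β = g_β`**, Cor. 2.3 (ii)), `eq_colemanSeries` (uniqueness: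
  any series with these values is `g_β`), `isUnit_constantCoeff_colemanSeries` (`g_β ∈ 𝒪_F⟦X⟧ˣ`),
  ★ `colemanSeries_mul` (**`g_{ββ'} = g_β g_{β'}`**, Cor. 2.3 (i)), `colemanSeries_one`.

## References

* E. de Shalit, *Iwasawa theory of elliptic curves with complex multiplication* (1987), Ch. I §2.2
  Theorem, §2.3 Corollary (i), (ii). [cite: deShalit1987, Ch. I §2.3]
* R. Coleman, *Division values in local fields*, Invent. Math. 53 (1979), Thm. A.

## Mathlib reuse

`Algebra.norm` (`map_mul`, `map_one`), `Classical.choose`; from the tree: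
`LubinTateColemanInterpolationNorm.lean` (`exists_evalAt_cohPt_eq_of_towerNorm`,
`isUnit_constantCoeff_of_norm_evalAt_eq_one`), `LubinTateColemanInterpolation.lean`
(`eq_of_forall_evalAt_cohPt_eq`), `LubinTateTowerRelNorm.lean` (`towerAlgebra`).
-/

noncomputable section

open Filter Topology Polynomial ValuativeRel
open scoped PowerSeries.WithPiTopology

namespace Literature.NumberTheory.GaloisRepresentations

section LocalFieldCS

open GaloisRepresentations.IsNonarchimedeanLocalField LubinTate

variable (F : Type*) [Field F] [ValuativeRel F] [TopologicalSpace F] [IsNonarchimedeanLocalField F]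

attribute [local instance] ltNormUniformSpace ltNormIsUniformAddGroup rk1 nF nE fintypeResidueField

variable {F}
variable {π : 𝒪[F]} (hπ : (valuation F).IsUniformizer (π : F))

/-- **Norm-coherent sequences of units** along the Lubin–Tate tower: `β_m ∈ 𝒪_{K_π^{m+1}}` of norm `1`
with `N_{K_π^{m+1}/K_π^{n+1}}(β_m) = β_n` for `n ≤ m` — the elements of `𝒰 = lim← U(K_π^{m+1})`.
[cite: deShalit1987, Ch. I §2.2] -/
structure NormCoherentUnits where
  /-- the components `β_m ∈ 𝒪_{K_π^{m+1}}` -/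
  val : ∀ m : ℕ, unitBall (ltField π m)
  /-- each `β_m` is a unit -/
  norm_eq_one : ∀ m, ‖((val m : unitBall (ltField π m)) : ltField π m)‖ = 1
  /-- norm-coherence along the tower -/
  coherent : ∀ n m (hnm : n ≤ m),
    @Algebra.norm (ltField π n) (ltField π m) _ _ (towerAlgebra (ltField_mono hπ hnm))
      ((val m : unitBall (ltField π m)) : ltField π m) = ((val n : unitBall (ltField π n)) : ltField π n)

namespace NormCoherentUnits

variable {hπ}

/-- Two norm-coherent sequences with the same components are equal. [cite: deShalit1987, Ch. I §2.2] -/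
@[ext] theorem ext {β β' : NormCoherentUnits hπ} (h : ∀ m, β.val m = β'.val m) : β = β' := by
  cases β; cases β'; congr; exact funext h

/-- The termwise product of norm-coherent sequences (norms are multiplicative). [cite: deShalit1987, Ch. I §2.3 (i)] -/
def mul (β β' : NormCoherentUnits hπ) : NormCoherentUnits hπ where
  val m := β.val m * β'.val m
  norm_eq_one m := by rw [Subring.coe_mul, norm_mul, β.norm_eq_one, β'.norm_eq_one, mul_one]
  coherent n m hnm := by
    letI := towerAlgebra (ltField_mono hπ hnm)
    rw [Subring.coe_mul, Subring.coe_mul, map_mul, β.coherent n m hnm, β'.coherent n m hnm]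

/-- The constant sequence `1`. [cite: deShalit1987, Ch. I §2.3 (i)] -/
def one : NormCoherentUnits hπ where
  val _ := 1
  norm_eq_one m := by rw [OneMemClass.coe_one, norm_one]
  coherent n m hnm := by
    letI := towerAlgebra (ltField_mono hπ hnm)
    rw [OneMemClass.coe_one, OneMemClass.coe_one, map_one]

/-- Components of the product (unfolding). [cite: deShalit1987, Ch. I §2.3 (i)] -/
@[simp] theorem val_mul (β β' : NormCoherentUnits hπ) (m : ℕ) : (β.mul β').val m = β.val m * β'.val m := rfl

/-- Components of `1` (unfolding). [cite: deShalit1987, Ch. I §2.3 (i)] -/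
@[simp] theorem val_one (m : ℕ) : (one : NormCoherentUnits hπ).val m = 1 := rfl

end NormCoherentUnits

/-- **Coleman's power series `g_β ∈ 𝒪_F⟦X⟧`** of a norm-coherent sequence of units `β`: the unique series
with `g_β(ω_{m+1}) = β_m` for all `m` (it satisfies `𝒩 g_β = g_β`). [cite: deShalit1987, Ch. I §2.2 Theorem] -/
def colemanSeries (β : NormCoherentUnits hπ) : PowerSeries (LTCoeff F) :=
  (exists_evalAt_cohPt_eq_of_towerNorm hπ β.val β.norm_eq_one β.coherent).choose

/-- ★ **`𝒩 g_β = g_β`** (Cor. 2.3 (ii)). [cite: deShalit1987, Ch. I §2.3 (ii)] -/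
theorem colemanNorm_colemanSeries (β : NormCoherentUnits hπ) :
    colemanNorm hπ 0 (colemanSeries hπ β) = colemanSeries hπ β :=
  (exists_evalAt_cohPt_eq_of_towerNorm hπ β.val β.norm_eq_one β.coherent).choose_spec.1

/-- ★ **`g_β(ω_{m+1}) = β_m`** for every `m`. [cite: deShalit1987, Ch. I §2.2 Theorem] -/
theorem evalAt_cohPt_colemanSeries (β : NormCoherentUnits hπ) (m : ℕ) :
    evalAt (maxNilIdeal F (ltField π m)) (cohPt hπ m) (colemanSeries hπ β) = β.val m :=
  (exists_evalAt_cohPt_eq_of_towerNorm hπ β.val β.norm_eq_one β.coherent).choose_spec.2 m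

/-- **Uniqueness**: a series taking the values `β_m` at all `ω_{m+1}` is `g_β`. [cite: deShalit1987, Ch. I §2.2 Theorem] -/
theorem eq_colemanSeries {β : NormCoherentUnits hπ} {g : PowerSeries (LTCoeff F)}
    (h : ∀ m, evalAt (maxNilIdeal F (ltField π m)) (cohPt hπ m) g = β.val m) : g = colemanSeries hπ β :=
  eq_of_forall_evalAt_cohPt_eq hπ fun m => by rw [h m, evalAt_cohPt_colemanSeries]

/-- **`g_β ∈ 𝒪_F⟦X⟧ˣ`**: its constant term is a unit. [cite: deShalit1987, Ch. I §2.2 Theorem] -/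
theorem isUnit_constantCoeff_colemanSeries (β : NormCoherentUnits hπ) :
    IsUnit (PowerSeries.constantCoeff (colemanSeries hπ β)) :=
  isUnit_constantCoeff_of_norm_evalAt_eq_one hπ (x := cohPt hπ 0) (by
    rw [evalAt_cohPt_colemanSeries]; exact β.norm_eq_one 0)

/-- `g_β` is a unit of `𝒪_F⟦X⟧`. [cite: deShalit1987, Ch. I §2.2 Theorem] -/
theorem isUnit_colemanSeries (β : NormCoherentUnits hπ) : IsUnit (colemanSeries hπ β) :=
  PowerSeries.isUnit_iff_constantCoeff.mpr (isUnit_constantCoeff_colemanSeries hπ β)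

/-- ★ **`g_{ββ'} = g_β · g_{β'}`** (Cor. 2.3 (i)). [cite: deShalit1987, Ch. I §2.3 (i)] -/
theorem colemanSeries_mul (β β' : NormCoherentUnits hπ) :
    colemanSeries hπ (β.mul β') = colemanSeries hπ β * colemanSeries hπ β' :=
  (eq_colemanSeries hπ (β := β.mul β') fun m => by
    rw [map_mul, evalAt_cohPt_colemanSeries, evalAt_cohPt_colemanSeries, NormCoherentUnits.val_mul]).symm

/-- `g_1 = 1`. [cite: deShalit1987, Ch. I §2.3 (i)] -/
theorem colemanSeries_one : colemanSeries hπ (NormCoherentUnits.one : NormCoherentUnits hπ) = 1 :=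
  (eq_colemanSeries hπ (β := NormCoherentUnits.one) fun m => by
    rw [map_one, NormCoherentUnits.val_one]).symm

/-- `𝒩 g_β = g_β` at every level. [cite: deShalit1987, Ch. I §2.3 (ii)] -/
theorem colemanNorm_colemanSeries_level (β : NormCoherentUnits hπ) (n : ℕ) :
    colemanNorm hπ n (colemanSeries hπ β) = colemanSeries hπ β := by
  rw [← colemanNorm_level_eq hπ 0 n]; exact colemanNorm_colemanSeries hπ β

end LocalFieldCS

end Literature.NumberTheory.GaloisRepresentations
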